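import Summits.BirchSwinnertonDyer.BirchSwinnertonDyer.Theorems.CyclotomicUntwistSigmaLineFamilyDivision
import Summits.BirchSwinnertonDyer.BirchSwinnertonDyer.Theorems.CyclotomicUntwistSigmaLineFamilyLevelTwoDatum
import Literature.NumberTheory.EllipticCurves.DivisionValuesDenominatorLawProofs
import Literature.NumberTheory.EllipticCurves.PadicPointsFiltrationProofs
import HarnessLib

/-!
# Route `CyclotomicUntwist`, crux K1 `PSRankOneLowerHalfAtThree` (stmt-BirchSwinnertonDyer-21580):
# the σ-LINE FAMILY — QUASI-QUADRATICITY `h_{σ_c}(nP) = n²·h_{σ_c}(P)` AT EVERY ADMISSIBLE POINT and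
# THE LEVEL-ONE DATUM (`v(z) ≥ 1`: the whole admissible locus, `p ≥ 3`)

Cell `pub/bsd-wall` (D-0145 line `route-BirchSwinnertonDyer-CyclotomicUntwist`), seat `bsd-line-cycu-p1`
g5, lane «σ-LINE FAMILY LAW — LEVEL-ONE DATUM», file 26 of the lane. THEOREMS ONLY (no definition, no
named fact, no `sorry`); helper `--supports` K1 = stmt-BirchSwinnertonDyer-21580. BSD is not proved by
this file and no crux is.

WHAT. The last rung of the census-facing ladder of `SIGMA-LINE-FAMILY-LAW-v4` ADDENDUM-1: the bilinear
σ_c-DATUM reads the σ_c-height at EVERY admissible point (`‖x‖_p > 1`, non-singular reduction at every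
prime), not only on `E⁽²⁾` (`…LevelTwoDatum`). For `W/ℚ` globally minimal, `p ≥ 3`, `‖c‖ ≤ 1`:

* §1 **`sigmaHeight_formalSigma_nsmul`** — `h_{σ_c}(nP) = n²·h_{σ_c}(P)` for every admissible `P` and
  `n ≥ 1` (`h = CensusX42.sigmaHeight W p σ_c = log_p den x − 2 log_p σ_c(z)`): the ARITHMETIC half
  `den x(nP) = den x(P)^{n²}·ΨSqₙ(x)` (Literature `den_zsmul_eq_den_pow_mul_eval_ΨSq`, Ayad / Silverman 2005
  Prop. 18) and the ANALYTIC half `σ_c(z(nP))² = σ_c(z(P))^{2n²}·ΨSqₙ(x)` (`…Division`, Mazur–Tate's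
  squared division identity on the closed disc) — the two factors `ΨSqₙ(x) = ψₙ(P)²` cancel under `log_p`;
* §2 `exists_prime_nsmul_levelTwo` — `pP` is affine, lies in `E⁽²⁾` (`‖z(pP)‖ ≤ p⁻²`, from
  `‖z(pP) − p·z(P)‖ ≤ ‖z(P)‖²`) and keeps non-singular reduction everywhere;
* §3 **`exists_heightDatum_formalSigma_levelOne`** — `∃ D : PAdicHeightData W p` with
  `D(P,P) = h_{σ_c}(P)` for EVERY `P = (x,y)` with `‖x‖_p > 1` and non-singular reduction at every prime
  (the level-two datum `D` of `…LevelTwoDatum`: `p²·D(P,P) = D(pP,pP) = h(pP) = p²·h(P)`);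
  **`heightDatum_levelOne_eq`** — uniqueness; `pairing_eq_sigmaHeight_of_isAdmissible` — the same read
  on the tree's admissible predicate `WeierstrassCurve.IsAdmissible`.

This is Bernardi's quasi-quadraticity of the naive σ_c-heights at an ADDITIVE (indeed any) prime for
the whole one-parameter family, in the Stein–Wuthrich normalisation of the census (`CensusX42.sigmaHeight`);
the census predicate `CensusX42.IsTwistSigmaHeight` (agreement on ALL admissible points) is thereby
satisfiable and rigid (sequel `…SigmaLineFamilyCensusHeight`).

References: Bernardi 1981 §1; Mazur–Tate 1991 Thm. 3.1; Mazur–Stein–Tate 2006 §1 (1.1), §2.6–2.7,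
Alg. 3.4 Step 1; Stein–Wuthrich 2013 §4.1 (4.1); Silverman 2005 Prop. 18. [cite: MazurSteinTate2006, §2.7]
[cite: MazurTate1991, Thm. 3.1] [cite: SteinWuthrich2013, §4.1 eq. (4.1)] [cite: Silverman2005DivPoly, §7
Prop. 18]
-/

set_option autoImplicit false
-- single-conjunct summit: `Summit.BirchSwinnertonDyer.BirchSwinnertonDyer.…` repeats the name by design
set_option linter.dupNamespace false

noncomputable section

open scoped Classical

open PowerSeries WeierstrassCurve Literature.NumberTheory.EllipticCurves
  Summit.BirchSwinnertonDyer.Rank1Residual.Additive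
  Summit.BirchSwinnertonDyer.BirchSwinnertonDyer.Theorems.PSSigmaLineFamilyAdmissible
  Summit.BirchSwinnertonDyer.BirchSwinnertonDyer.Theorems.PSSigmaLineFamilyDivision
  Summit.BirchSwinnertonDyer.BirchSwinnertonDyer.Theorems.PSSigmaLineFamilyLevelTwoDatum
  Summit.BirchSwinnertonDyer.BirchSwinnertonDyer.Theorems.PSSigmaLineFamilyHeightDatumUnique

namespace Summit.BirchSwinnertonDyer.BirchSwinnertonDyer.Theorems.PSSigmaLineFamilyLevelOneDatum

variable {p : ℕ} [Fact p.Prime] (W : WeierstrassCurve ℚ) [W.IsElliptic] [W.IsGloballyMinimal]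

/-! ### §1 Quasi-quadraticity of the σ_c-heights under multiplication -/

omit [W.IsElliptic] [W.IsGloballyMinimal] in
/-- `log_p(aⁿ) = n·log_p(a)` for `a ≠ 0` (Iwasawa logarithm). [Iwasawa 1972, §4.4] [cite: Iwasawa1972PadicL, §4.4] -/
theorem padicLog_pow {a : ℚ_[p]} (ha : a ≠ 0) (n : ℕ) : padicLog p (a ^ n) = n * padicLog p a := by
  induction n with
  | zero => rw [pow_zero, padicLog_one, Nat.cast_zero, zero_mul]
  | succ n ih =>
    rw [pow_succ, padicLog_mul_holds p (pow_ne_zero n ha) ha, ih, Nat.cast_succ]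
    ring

/-- **QUASI-QUADRATICITY `h_{σ_c}(nP) = n²·h_{σ_c}(P)` at every admissible point.** `W/ℚ` globally
minimal, `p ≥ 3`, `‖c‖_p ≤ 1`, `P = (x, y) ∈ E(ℚ)` with `‖x‖_p > 1` and non-singular reduction modulo every
prime, `n ≥ 1`, `nP = (x', y')`. Then for the census σ-height `h = log_p den x − 2 log_p σ_c(−x/y)`:
`h(nP) = n²·h(P)`. Proof: `den x' = (den x)^{n²}·ΨSqₙ(x)` (Literature, Ayad / Silverman 2005) and
`σ_c(z(nP))² = σ_c(z(P))^{2n²}·ΨSqₙ(x)` (Mazur–Tate's division identity on the closed disc); the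
`log_p ΨSqₙ(x)` cancel. [Bernardi 1981, §1; Mazur–Stein–Tate 2006, §1 (1.1) and Alg. 3.4 Step 1]
[cite: MazurSteinTate2006, §2.7] [cite: MazurTate1991, Thm. 3.1] -/
theorem sigmaHeight_formalSigma_nsmul (hp : 3 ≤ p) {c : ℚ_[p]} (hc : ‖c‖ ≤ 1) {x y : ℚ}
    (h : W.toAffine.Nonsingular x y) (hx : 1 < ‖(x : ℚ_[p])‖)
    (hns : ∀ ℓ : ℕ, ℓ.Prime → W.HasNonsingularReductionAt ℓ x y) {n : ℕ} (hn : 1 ≤ n) {x' y' : ℚ}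
    (h' : W.toAffine.Nonsingular x' y') (hmul : n • (.some x y h : W.toAffine.Point) = .some x' y' h') :
    CensusX42.sigmaHeight W p ((W.baseChange ℚ_[p]).formalSigma c) (.some x' y' h') =
      (n : ℚ_[p]) ^ 2 * CensusX42.sigmaHeight W p ((W.baseChange ℚ_[p]).formalSigma c) (.some x y h) := by
  set V := W.baseChange ℚ_[p] with hVdef
  haveI : V.IsIntegral ℤ_[p] := by rw [hVdef]; infer_instance
  have hmulZ : (n : ℤ) • (.some x y h : W.toAffine.Point) = .some x' y' h' := by
    rw [natCast_zsmul]; exact hmul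
  -- arithmetic half
  have hden := W.den_zsmul_eq_den_pow_mul_eval_ΨSq h h' hmulZ hns
  rw [Int.natAbs_natCast] at hden
  have hΨ : (W.ΨSq n).eval x ≠ 0 := W.eval_ΨSq_ne_zero_of_zsmul_eq_some h h' hmulZ
  have hΨ' : (((W.ΨSq n).eval x : ℚ) : ℚ_[p]) ≠ 0 := by exact_mod_cast hΨ
  have hdenp : ((x'.den : ℚ) : ℚ_[p]) = ((x.den : ℚ) : ℚ_[p]) ^ (n ^ 2) * (((W.ΨSq n).eval x : ℚ) : ℚ_[p]) := by
    have := congrArg (fun q : ℚ => (q : ℚ_[p])) hden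
    push_cast at this ⊢
    exact this
  -- analytic half
  have hσ := padicEval_formalSigma_nsmul_sq_rat W hp hc h hx hn h' hmul
  -- non-vanishing
  have hd : ∀ q : ℚ, ((q.den : ℚ) : ℚ_[p]) ≠ 0 := fun q => by exact_mod_cast q.den_nz
  have hσP := (sigma_admissible V hp hc (nonsingular_ratCast (p := p) h).1 hx).2.2
  have hσQ : padicEval (V.formalSigma c) (-(x' : ℚ_[p]) / (y' : ℚ_[p])) ≠ 0 := by
    intro h0
    rw [h0, zero_pow two_ne_zero] at hσ
    exact (mul_ne_zero (pow_ne_zero _ hσP) hΨ') hσ.symm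
  -- logarithms
  have hlogd : padicLog p ((x'.den : ℚ) : ℚ_[p]) =
      (n : ℚ_[p]) ^ 2 * padicLog p ((x.den : ℚ) : ℚ_[p]) + padicLog p (((W.ΨSq n).eval x : ℚ) : ℚ_[p]) := by
    rw [hdenp, padicLog_mul_holds p (pow_ne_zero _ (hd x)) hΨ', padicLog_pow (hd x)]
    push_cast; ring
  have hlogσ : 2 * padicLog p (padicEval (V.formalSigma c) (-(x' : ℚ_[p]) / (y' : ℚ_[p]))) =
      (n : ℚ_[p]) ^ 2 * (2 * padicLog p (padicEval (V.formalSigma c) (-(x : ℚ_[p]) / (y : ℚ_[p])))) +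
        padicLog p (((W.ΨSq n).eval x : ℚ) : ℚ_[p]) := by
    rw [← padicLog_sq hσQ, hσ, padicLog_mul_holds p (pow_ne_zero _ hσP) hΨ', padicLog_pow hσP]
    push_cast; ring
  simp only [PSSigmaLineFamilyValues.sigmaHeight_some]
  linear_combination hlogd - hlogσ

/-! ### §2 `pP` lies one level deeper -/

omit [W.IsGloballyMinimal] in
/-- **`pP ∈ E⁽²⁾ ∩ ⋂_ℓ E⁰(ℚ_ℓ)` for admissible `P`** (`p ≥ 3`, `W` globally minimal): `pP = (x', y')` is
affine (admissible points are non-torsion), `‖x'‖_p > 1`, `‖z(pP)‖_p ≤ p⁻²` (`‖z(pP) − p·z(P)‖ ≤ ‖z(P)‖²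
≤ p⁻²`, `‖p·z(P)‖ ≤ p⁻²`), and `pP` reduces non-singularly at every prime (a subgroup condition).
[Silverman AEC IV.3.2, VII.2.2; Mazur–Stein–Tate 2006, Alg. 3.4 Step 1] [cite: SilvermanAEC2009, VII.2.2]
[cite: MazurSteinTate2006, §2.7] -/
theorem exists_prime_nsmul_levelTwo [W.IsGloballyMinimal] (hp : 3 ≤ p) {x y : ℚ}
    (h : W.toAffine.Nonsingular x y) (hx : 1 < ‖(x : ℚ_[p])‖)
    (hns : ∀ ℓ : ℕ, ℓ.Prime → W.HasNonsingularReductionAt ℓ x y) :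
    ∃ (x' y' : ℚ) (h' : W.toAffine.Nonsingular x' y'),
      p • (.some x y h : W.toAffine.Point) = .some x' y' h' ∧ 1 < ‖(x' : ℚ_[p])‖ ∧
        ‖(-(x' : ℚ_[p]) / (y' : ℚ_[p]))‖ ≤ ((p : ℝ)⁻¹) ^ 2 ∧
          ∀ ℓ : ℕ, ℓ.Prime → W.HasNonsingularReductionAt ℓ x' y' := by
  set V := W.baseChange ℚ_[p] with hVdef
  haveI : V.IsIntegral ℤ_[p] := by rw [hVdef]; infer_instance
  haveI : V.IsElliptic := by rw [hVdef]; infer_instance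
  have hP : V.IsInReductionKernel (.some (x : ℚ_[p]) (y : ℚ_[p]) (nonsingular_ratCast h)) :=
    (V.isInReductionKernel_some _).mpr hx
  -- `pP` is affine
  have hfin : ¬ IsOfFinAddOrder (.some x y h : W.toAffine.Point) := fun hf =>
    not_isOfFinAddOrder_of_one_lt_padicNorm_holds W p hp h hx hf
  rcases hQ : p • (.some x y h : W.toAffine.Point) with _ | ⟨x', y', h'⟩
  · exact (hfin (isOfFinAddOrder_iff_nsmul_eq_zero.mpr ⟨p, (Fact.out : p.Prime).pos, hQ⟩)).elim
  refine ⟨x', y', h', rfl, ?_, ?_, ?_⟩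
  · -- `‖x'‖ > 1`: `pP ∈ E₁(ℚ_p)`
    have hker := V.isInReductionKernel_nsmul hP p
    rw [← toPadicPoint_some (p := p) h, ← map_nsmul, hQ, toPadicPoint_some] at hker
    exact (V.isInReductionKernel_some _).mp hker
  · -- `‖z(pP)‖ ≤ p⁻²`
    have hz : ‖V.formalParameter (.some (x : ℚ_[p]) (y : ℚ_[p]) (nonsingular_ratCast h))‖ ≤ (p : ℝ)⁻¹ := by
      rw [formalParameter_some]; exact norm_param_le_inv_prime V (nonsingular_ratCast (p := p) h).1 hx
    have hsub := V.norm_formalParameter_nsmul_sub_le hP p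
    have hpar : V.formalParameter (p • (.some (x : ℚ_[p]) (y : ℚ_[p]) (nonsingular_ratCast h))) =
        -(x' : ℚ_[p]) / (y' : ℚ_[p]) := by
      rw [← toPadicPoint_some (p := p) h, ← map_nsmul, hQ, toPadicPoint_some, formalParameter_some]
    rw [hpar] at hsub
    have hp0 : (0 : ℝ) ≤ (p : ℝ)⁻¹ := inv_nonneg.mpr (Nat.cast_nonneg p)
    have h1 : ‖V.formalParameter (.some (x : ℚ_[p]) (y : ℚ_[p]) (nonsingular_ratCast h))‖ ^ 2 ≤
        ((p : ℝ)⁻¹) ^ 2 := pow_le_pow_left₀ (norm_nonneg _) hz 2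
    have h2 : ‖(p : ℚ_[p]) * V.formalParameter (.some (x : ℚ_[p]) (y : ℚ_[p]) (nonsingular_ratCast h))‖ ≤
        ((p : ℝ)⁻¹) ^ 2 := by
      rw [norm_mul, Padic.norm_p, sq]
      exact mul_le_mul_of_nonneg_left hz hp0
    calc ‖-(x' : ℚ_[p]) / (y' : ℚ_[p])‖
        = ‖(-(x' : ℚ_[p]) / (y' : ℚ_[p]) - (p : ℚ_[p]) * V.formalParameter (.some (x : ℚ_[p]) (y : ℚ_[p])
              (nonsingular_ratCast h))) +
            (p : ℚ_[p]) * V.formalParameter (.some (x : ℚ_[p]) (y : ℚ_[p]) (nonsingular_ratCast h))‖ := by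
          rw [sub_add_cancel]
      _ ≤ max ‖-(x' : ℚ_[p]) / (y' : ℚ_[p]) - (p : ℚ_[p]) * V.formalParameter (.some (x : ℚ_[p]) (y : ℚ_[p])
              (nonsingular_ratCast h))‖
            ‖(p : ℚ_[p]) * V.formalParameter (.some (x : ℚ_[p]) (y : ℚ_[p]) (nonsingular_ratCast h))‖ :=
          Padic.nonarchimedean _ _
      _ ≤ ((p : ℝ)⁻¹) ^ 2 := max_le (hsub.trans h1) h2
  · -- non-singular reduction of `pP` everywhere
    intro ℓ hℓ
    haveI : Fact ℓ.Prime := ⟨hℓ⟩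
    have hmem : (.some x y h : W.toAffine.Point) ∈ W.nonsingularReductionSubgroupAt ℓ :=
      (mem_nonsingularReductionSubgroupAt_iff _).mpr (hns ℓ hℓ)
    have hmem' := (W.nonsingularReductionSubgroupAt ℓ).nsmul_mem hmem p
    rw [hQ] at hmem'
    exact (mem_nonsingularReductionSubgroupAt_iff _).mp hmem'

/-! ### §3 The σ_c-datum on the whole admissible locus -/

/-- **THE LEVEL-ONE σ_c-DATUM (`p ≥ 3`).** For `W/ℚ` globally minimal and `‖c‖_p ≤ 1` there is a
`p`-adic height datum `D : PAdicHeightData W p` (symmetric, bilinear, killing torsion) with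
`D(P,P) = h_{σ_c}(P)` for EVERY `P = (x, y) ∈ E(ℚ)` with `‖x‖_p > 1` and non-singular reduction modulo
every prime — the census's admissible locus (`v(z(P)) ≥ 1`, the boundary of Bernardi's disc included).
It is the level-two datum `D` of `…LevelTwoDatum`: `p²·D(P,P) = D(pP,pP) = h_{σ_c}(pP) = p²·h_{σ_c}(P)`
(§1 with `n = p`, §2). [Mazur–Stein–Tate 2006, §2.6–2.7; Bernardi 1981, §1; Schneider 1982, §1]
[cite: MazurSteinTate2006, §2.7] [cite: Schneider1982PadicHeightI, §1] -/
theorem exists_heightDatum_formalSigma_levelOne (hp3 : 3 ≤ p) {c : ℚ_[p]} (hc : ‖c‖ ≤ 1) :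
    ∃ D : PAdicHeightData W p, ∀ {x y : ℚ} (h : W.toAffine.Nonsingular x y),
      1 < ‖(x : ℚ_[p])‖ → (∀ ℓ : ℕ, ℓ.Prime → W.HasNonsingularReductionAt ℓ x y) →
        D.pairing (.some x y h) (.some x y h) =
          CensusX42.sigmaHeight W p ((W.baseChange ℚ_[p]).formalSigma c) (.some x y h) := by
  obtain ⟨D, hD⟩ := exists_heightDatum_formalSigma_levelTwo W hp3 hc
  refine ⟨D, fun {x y} h hx hns => ?_⟩
  obtain ⟨x', y', h', hQ, hx', hz', hns'⟩ := exists_prime_nsmul_levelTwo W hp3 h hx hns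
  have hp1 : 1 ≤ p := (Fact.out : p.Prime).one_le
  have hval := hD h' hx' hz' hns'
  have hhgt := sigmaHeight_formalSigma_nsmul W hp3 hc h hx hns hp1 h' hQ
  have hpair : D.pairing (.some x' y' h') (.some x' y' h') =
      (p : ℚ_[p]) ^ 2 * D.pairing (.some x y h) (.some x y h) := by
    rw [← hQ, map_nsmul, D.symm (p • (.some x y h : W.toAffine.Point)) (.some x y h), map_nsmul, smul_smul,
      nsmul_eq_mul]
    push_cast; ring
  have hp0 : (p : ℚ_[p]) ^ 2 ≠ 0 := pow_ne_zero 2 (Nat.cast_ne_zero.mpr (Fact.out : p.Prime).ne_zero)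
  rw [hpair, hhgt] at hval
  exact mul_left_cancel₀ hp0 hval

/-- **Uniqueness of the level-one datum**: two data reading `h_{σ_c}` on the admissible locus agree on
the level-two locus, hence are EQUAL (`heightDatum_levelTwo_eq`). [cite: MazurSteinTate2006, §2.7] -/
theorem heightDatum_levelOne_eq {c : ℚ_[p]} {D₁ D₂ : PAdicHeightData W p}
    (hD₁ : ∀ {x y : ℚ} (h : W.toAffine.Nonsingular x y),
      1 < ‖(x : ℚ_[p])‖ → (∀ ℓ : ℕ, ℓ.Prime → W.HasNonsingularReductionAt ℓ x y) →
        D₁.pairing (.some x y h) (.some x y h) =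
          CensusX42.sigmaHeight W p ((W.baseChange ℚ_[p]).formalSigma c) (.some x y h))
    (hD₂ : ∀ {x y : ℚ} (h : W.toAffine.Nonsingular x y),
      1 < ‖(x : ℚ_[p])‖ → (∀ ℓ : ℕ, ℓ.Prime → W.HasNonsingularReductionAt ℓ x y) →
        D₂.pairing (.some x y h) (.some x y h) =
          CensusX42.sigmaHeight W p ((W.baseChange ℚ_[p]).formalSigma c) (.some x y h)) :
    D₁ = D₂ :=
  heightDatum_levelTwo_eq W (fun h hx _ hns => hD₁ h hx hns) (fun h hx _ hns => hD₂ h hx hns)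

/-- **`∃!`**: exactly one height datum reads `h_{σ_c}` on the admissible locus (`p ≥ 3`, `‖c‖ ≤ 1`).
[cite: MazurSteinTate2006, §2.7] -/
theorem existsUnique_heightDatum_formalSigma_levelOne (hp3 : 3 ≤ p) {c : ℚ_[p]} (hc : ‖c‖ ≤ 1) :
    ∃! D : PAdicHeightData W p, ∀ (x y : ℚ) (h : W.toAffine.Nonsingular x y),
      1 < ‖(x : ℚ_[p])‖ → (∀ ℓ : ℕ, ℓ.Prime → W.HasNonsingularReductionAt ℓ x y) →
        D.pairing (.some x y h) (.some x y h) =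
          CensusX42.sigmaHeight W p ((W.baseChange ℚ_[p]).formalSigma c) (.some x y h) := by
  obtain ⟨D, hD⟩ := exists_heightDatum_formalSigma_levelOne W hp3 hc
  exact ⟨D, fun x y h hx hns => hD h hx hns, fun D' hD' =>
    heightDatum_levelOne_eq W (fun h hx hns => hD' _ _ h hx hns) (fun h hx hns => hD h hx hns)⟩

omit [W.IsElliptic] [W.IsGloballyMinimal] in
/-- **On the tree's admissible predicate**: a datum reading `h_{σ_c}` on the level-one locus reads it at
every `WeierstrassCurve.IsAdmissible p` point (`IsAdmissible` = non-torsion ∧ `‖x‖_p > 1` ∧ `z` in the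
sigma disc ∧ non-singular reduction everywhere). [cite: MazurSteinTate2006, §1] -/
theorem pairing_eq_sigmaHeight_of_isAdmissible {c : ℚ_[p]} {D : PAdicHeightData W p}
    (hD : ∀ {x y : ℚ} (h : W.toAffine.Nonsingular x y),
      1 < ‖(x : ℚ_[p])‖ → (∀ ℓ : ℕ, ℓ.Prime → W.HasNonsingularReductionAt ℓ x y) →
        D.pairing (.some x y h) (.some x y h) =
          CensusX42.sigmaHeight W p ((W.baseChange ℚ_[p]).formalSigma c) (.some x y h))
    {P : W.toAffine.Point} (hP : W.IsAdmissible p P) :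
    D.pairing P P = CensusX42.sigmaHeight W p ((W.baseChange ℚ_[p]).formalSigma c) P := by
  rcases P with _ | ⟨x, y, h⟩
  · exact (hP.2).elim
  · exact hD h hP.2.1 hP.2.2.2

end Summit.BirchSwinnertonDyer.BirchSwinnertonDyer.Theorems.PSSigmaLineFamilyLevelOneDatum

end
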